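import Summits.ResolutionOfSingularities.ResolutionOfSingularities.Theorems.WeightedInvariantLocalWeightedDropWildPurePowerFlagDefs
import Literature.AlgebraicGeometry.Resolution.PointBlowupFlagStepTyped

/-!
# `LocalWeightedDrop`, piece S3πM: the flag invariant along the axis successor `X 0 ^ q · T = B(x, xy)` (`t = 0`) —
# bookkeeping and [HP24, Prop. 4] case (iii) on the game side

Crux item stmt-ResolutionOfSingularities-8899 `LocalWeightedDrop` (route `ResolutionOfSingularities/WeightedInvariant`), line
`hasse-ridge-face-selection`, class stub S3πM `stub_wildPurelyInseparableReductionWon`, sub-target `PurePowerFlag.DropStatement` of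
res-L1-w43-stub-1's assembly (the measure drops along the normalised point-blow-up successors).  [OURS · L1 W4.3, chain w43, seat
res-D-pv-058 acting as res-L1-w43-stub-6.  The printed mathematics is H. Hauser, S. Perlega, Publ. RIMS **60** (2024) Prop. 4,
proof of cases (i) and (iii) (pp. 794–795), formalised at SERIES LEVEL in `Literature/…/PointBlowupFlagDropMonomialStep`,
`…/PointBlowupFlagTangentStep`, `…/PointBlowupFlagStepTyped`; this file is the GLUE to the game-side definitions
`PurePowerFlag.*` (p504698).  Not a statement of any manuscript under adjudication.]

For a clean position `B` (`cleanSeries q B = B`, `B ≠ 0`, `q ≤ ord B`) and its axis successor `T` (`X 0 ^ q * T = subst (dirChart 0) B`):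
* the successor is the monomial step of the series files (`subst_dirChart_zero_eq`) and is CLEAN (`cleanSeries_of_stepZero`);
* exceptional exponents: `ordAlong 1 T = ordAlong 1 B`, `ordAlong 0 T = ord B − q` (`ordAlong_one_stepZero`, `ordAlong_zero_stepZero`),
  `excExp ≤` every support exponent, `ord = r_x + r_y + d_res` (`order_toNat_eq_excExp_add_dRes`);
* **`dRes T E′ ≤ dRes B E`** for the successor letters `E′` (`0 ∈ E′`, `1 ∈ E′ ↔ 1 ∈ E`) (`dRes_stepZero_le`);
* **[HP24, Prop. 4 (iii)] game side**: for a tangent flag `h` of the successor, `X·h` is a tangent flag of `B` with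
  `dFlag q T h n = dFlag q B (X·h) (n+1)` and `flagTriple q T E′ h < flagTriple q B E (X·h)` (`exists_gt_of_isTangent_stepZero`).
-/

set_option linter.dupNamespace false -- mandated namespace of this single-conjunct summit

namespace Summit.ResolutionOfSingularities.ResolutionOfSingularities.Theorems

open Literature.AlgebraicGeometry.Resolution
open Literature.AlgebraicGeometry.Resolution.HauserPerlega2024

namespace PurePowerFlag

open MvPowerSeries

variable {k : Type} [Field k]

/-! ### Two letters -/

/-- `Fin 2` has the two letters `0`, `1`. -/
theorem fin_two_cases : ∀ l : Fin 2, l = 0 ∨ l = 1 := by decide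

/-- `0 ≠ 1` in `Fin 2`. -/
theorem zero_ne_one_fin : (0 : Fin 2) ≠ 1 := by decide

/-- the exponent `x^a y^b` at `0`. -/
private theorem e_l (a b : ℕ) : (Finsupp.single (0 : Fin 2) a + Finsupp.single (1 : Fin 2) b : Fin 2 →₀ ℕ) 0 = a := by
  rw [Finsupp.add_apply, Finsupp.single_eq_same, Finsupp.single_apply, if_neg (by decide), add_zero]

/-- the exponent `x^a y^b` at `1`. -/
private theorem e_r (a b : ℕ) : (Finsupp.single (0 : Fin 2) a + Finsupp.single (1 : Fin 2) b : Fin 2 →₀ ℕ) 1 = b := by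
  rw [Finsupp.add_apply, Finsupp.single_eq_same, Finsupp.single_apply, if_neg (by decide), zero_add]

/-- an exponent on two letters is `x^{m 0} y^{m 1}`. -/
private theorem e_ssa (m : Fin 2 →₀ ℕ) : m = Finsupp.single 0 (m 0) + Finsupp.single 1 (m 1) := by
  ext l
  rcases fin_two_cases l with rfl | rfl
  · rw [e_l]
  · rw [e_r]

/-- the degree on two letters. -/
private theorem e_deg (m : Fin 2 →₀ ℕ) : m.degree = m 0 + m 1 := by
  rw [Finsupp.degree_eq_sum, Fin.sum_univ_two]

/-! ### The axis successor is the monomial step of the series files, and it is clean -/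

/-- `B(x, x(0 + y))` is the monomial step `B(x, xy)` of `PointBlowupFlagDropMonomialStep` (`x = X 0`, `y = X 1`). -/
theorem subst_dirChart_zero_eq (B : MvPowerSeries (Fin 2) k) :
    subst (PlaneGerm.dirChart (0 : k)) B =
      subst (fun l : Fin 2 => if l = (1 : Fin 2) then (X 0 : MvPowerSeries (Fin 2) k) * X 1 else X l) B := by
  rw [← step_eq_dirChart_zero]

open Classical in
/-- cleaning commutes with multiplication by `x^q`. -/
theorem cleanSeries_X_pow_mul (q : ℕ) (T : MvPowerSeries (Fin 2) k) :
    cleanSeries q ((X 0 : MvPowerSeries (Fin 2) k) ^ q * T) = (X 0 : MvPowerSeries (Fin 2) k) ^ q * cleanSeries q T := by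
  ext m
  rw [coeff_cleanSeries, X_pow_eq, coeff_monomial_mul, coeff_monomial_mul, coeff_cleanSeries]
  by_cases hle : Finsupp.single (0 : Fin 2) q ≤ m
  · rw [if_pos hle, if_pos hle, one_mul, one_mul]
    have hmx : q ≤ m 0 := by have := hle 0; rwa [Finsupp.single_eq_same] at this
    have hiff : (∀ i, q ∣ m i) ↔ ∀ i, q ∣ (m - Finsupp.single (0 : Fin 2) q : Fin 2 →₀ ℕ) i := by
      constructor
      · intro H i
        rw [Finsupp.tsub_apply, Finsupp.single_apply]
        split_ifs with hi
        · subst hi; exact Nat.dvd_sub (H 0) dvd_rfl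
        · rw [Nat.sub_zero]; exact H i
      · intro H i
        have Hi := H i
        rw [Finsupp.tsub_apply, Finsupp.single_apply] at Hi
        split_ifs at Hi with hi
        · subst hi
          have := Nat.dvd_add Hi (dvd_refl q)
          rwa [Nat.sub_add_cancel hmx] at this
        · rwa [Nat.sub_zero] at Hi
    by_cases hd : ∀ i, q ∣ m i
    · rw [if_pos hd, if_pos (hiff.mp hd)]
    · rw [if_neg hd, if_neg (fun H => hd (hiff.mpr H))]
  · rw [if_neg hle, if_neg hle]
    split_ifs <;> rfl

/-- **the axis successor of a clean position is clean**: "If `t = 0`, the expansion of `F′(x,y)` is again clean" [HP24 §2 p. 774 /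
§4 p. 779]. -/
theorem cleanSeries_of_stepZero (q : ℕ) {B T : MvPowerSeries (Fin 2) k} (hB : cleanSeries q B = B)
    (hT : (X 0 : MvPowerSeries (Fin 2) k) ^ q * T = subst (PlaneGerm.dirChart (0 : k)) B) : cleanSeries q T = T := by
  apply X_pow_mul_left_cancel (0 : Fin 2) q
  rw [← cleanSeries_X_pow_mul, hT, subst_dirChart_zero_eq, cleanSeries_subst_step q 0 1 zero_ne_one_fin fin_two_cases, hB]

/-! ### Exceptional exponents and the residual order -/

/-- `ord_{X i} B ≤ m i` for a support exponent `m`. -/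
theorem ordAlong_le_of_coeff_ne_zero (i : Fin 2) {B : MvPowerSeries (Fin 2) k} {m : Fin 2 →₀ ℕ} (hm : coeff m B ≠ 0) :
    ordAlong i B ≤ ((m i : ℕ) : ℕ∞) := by
  unfold ordAlong
  exact iInf₂_le m (by rw [← MvPowerSeries.coeff_apply B m]; exact hm)

/-- the characterisation of `ord_{X i} B = r`: some support exponent has `i`-entry `r` and none has less. -/
theorem ordAlong_eq_natCast_iff (i : Fin 2) (B : MvPowerSeries (Fin 2) k) (r : ℕ) :
    ordAlong i B = r ↔ (∃ m, coeff m B ≠ 0 ∧ m i = r) ∧ ∀ m, coeff m B ≠ 0 → r ≤ m i := by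
  constructor
  · intro h
    have hne : ordAlong i B ≠ ⊤ := by rw [h]; exact WithTop.natCast_ne_top r
    unfold ordAlong at h hne
    refine ⟨?_, fun m hm => ?_⟩
    · by_contra hnone
      push Not at hnone
      -- every support exponent has `i`-entry `≠ r`, and all are `≥ r`: so all are `> r`, contradiction with the infimum
      have hge : ∀ m, B m ≠ 0 → ((r + 1 : ℕ) : ℕ∞) ≤ ((m i : ℕ) : ℕ∞) := by
        intro m hm
        have h1 : ((r : ℕ) : ℕ∞) ≤ (m i : ℕ∞) := by
          rw [← h]; exact iInf₂_le m hm
        have h2 : m i ≠ r := hnone m (by rw [MvPowerSeries.coeff_apply]; exact hm)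
        exact_mod_cast (show r + 1 ≤ m i by have := (Nat.cast_le (α := ℕ∞)).mp h1; omega)
      have : ((r + 1 : ℕ) : ℕ∞) ≤ (r : ℕ∞) := by rw [← h]; exact le_iInf₂ hge
      exact absurd (by exact_mod_cast this : r + 1 ≤ r) (by omega)
    · rw [← Nat.cast_le (α := ℕ∞), ← h]
      exact iInf₂_le m (by rw [← MvPowerSeries.coeff_apply B m]; exact hm)
  · rintro ⟨⟨m, hm, hmi⟩, hmin⟩
    unfold ordAlong
    apply le_antisymm
    · exact le_trans (iInf₂_le m (by rw [← MvPowerSeries.coeff_apply B m]; exact hm)) (by rw [hmi])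
    · exact le_iInf₂ fun m' hm' => by exact_mod_cast hmin m' (by rw [MvPowerSeries.coeff_apply]; exact hm')

/-- the exceptional exponent, letter by letter. -/
theorem excExp_apply (B : MvPowerSeries (Fin 2) k) (E : Finset (Fin 2)) (l : Fin 2) :
    excExp B E l = if l ∈ E then (ordAlong l B).toNat else 0 := by
  classical
  unfold excExp
  rw [Finsupp.finsetSum_apply]
  simp_rw [Finsupp.single_apply]
  rw [Finset.sum_ite_eq' E l]

/-- **the exceptional monomial divides**: `excExp B E ≤ m` for every support exponent `m`. [HP24 §4 p. 776: "M … divides F"] -/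
theorem excExp_le_of_coeff_ne_zero (B : MvPowerSeries (Fin 2) k) (E : Finset (Fin 2)) {m : Fin 2 →₀ ℕ}
    (hm : coeff m B ≠ 0) : excExp B E ≤ m := by
  intro l
  rw [excExp_apply]
  split_ifs with hl
  · exact ENat.toNat_le_of_le_coe (ordAlong_le_of_coeff_ne_zero l hm)
  · exact Nat.zero_le _

/-- **`ord B = r_x + r_y + d_res`** for `B ≠ 0` ("`d_res = ord G = ord F − ord_{E_a} F`" [HP24 §4 p. 776]). -/
theorem order_toNat_eq_excExp_add_dRes {B : MvPowerSeries (Fin 2) k} (hB : B ≠ 0) (E : Finset (Fin 2)) :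
    B.order.toNat = excExp B E 0 + excExp B E 1 + dRes B E := by
  classical
  obtain ⟨m₀, hm₀, hdeg⟩ := MvPowerSeries.exists_coeff_ne_zero_and_order ((MvPowerSeries.ne_zero_iff_order_finite).mp hB)
  have hle := excExp_le_of_coeff_ne_zero B E hm₀
  have h0 := hle 0
  have h1 := hle 1
  have hsum : ∑ i ∈ E, (ordAlong i B).toNat = excExp B E 0 + excExp B E 1 := by
    have : ∀ E' : Finset (Fin 2), ∑ i ∈ E', (ordAlong i B).toNat = (∑ i ∈ E', Finsupp.single i (ordAlong i B).toNat) 0 +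
        (∑ i ∈ E', Finsupp.single i (ordAlong i B).toNat) 1 := by
      intro E'
      rw [Finsupp.finsetSum_apply, Finsupp.finsetSum_apply, ← Finset.sum_add_distrib]
      refine Finset.sum_congr rfl fun i _ => ?_
      rcases fin_two_cases i with rfl | rfl
      · rw [Finsupp.single_eq_same, Finsupp.single_apply, if_neg (by decide), add_zero]
      · rw [Finsupp.single_eq_same, Finsupp.single_apply, if_neg (by decide), zero_add]
    exact this E
  have hord : B.order.toNat = m₀ 0 + m₀ 1 := by
    have h2 : ((B.order.toNat : ℕ) : ℕ∞) = ((m₀ 0 + m₀ 1 : ℕ) : ℕ∞) := by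
      rw [(MvPowerSeries.ne_zero_iff_order_finite).mp hB, ← hdeg, e_deg]
    exact_mod_cast h2
  unfold dRes
  rw [hsum]
  omega

/-! ### The successor's exponents -/

/-- **`y`-exponents are preserved by the step**: `ord_y T = ord_y B`. -/
theorem ordAlong_one_stepZero (q : ℕ) {B T : MvPowerSeries (Fin 2) k}
    (hT : (X 0 : MvPowerSeries (Fin 2) k) ^ q * T = subst (PlaneGerm.dirChart (0 : k)) B) :
    ordAlong 1 T = ordAlong 1 B := by
  rw [subst_dirChart_zero_eq] at hT
  unfold ordAlong
  apply le_antisymm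
  · refine le_iInf₂ fun m hm => ?_
    obtain ⟨-, hcoef⟩ := coeff_eq_of_step' q 0 1 zero_ne_one_fin fin_two_cases B T hT m
      (by rw [MvPowerSeries.coeff_apply]; exact hm)
    have hne : T (Finsupp.single 0 (m 0 + m 1 - q) + Finsupp.single 1 (m 1)) ≠ 0 := by
      rw [← MvPowerSeries.coeff_apply T, hcoef, MvPowerSeries.coeff_apply]; exact hm
    exact le_trans (iInf₂_le (Finsupp.single (0 : Fin 2) (m 0 + m 1 - q) + Finsupp.single 1 (m 1)) hne) (by rw [e_r])
  · refine le_iInf₂ fun m hm => ?_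
    have h1 := coeff_eq_of_step q 0 1 zero_ne_one_fin fin_two_cases B T hT m
    by_cases hle : m 1 ≤ m 0 + q
    · rw [if_pos hle, MvPowerSeries.coeff_apply, MvPowerSeries.coeff_apply] at h1
      have hne : B (Finsupp.single 0 (m 0 + q - m 1) + Finsupp.single 1 (m 1)) ≠ 0 := by rw [← h1]; exact hm
      exact le_trans (iInf₂_le (Finsupp.single (0 : Fin 2) (m 0 + q - m 1) + Finsupp.single 1 (m 1)) hne) (by rw [e_r])
    · rw [if_neg hle, MvPowerSeries.coeff_apply] at h1
      exact absurd h1 hm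

/-- **the new exceptional `x`-exponent is `ord B − q`** ("`M′(x,y) = x^{d_res−pᵉ}M(x,xy)`" [HP24 Prop. 4 (i) p. 794]). -/
theorem ordAlong_zero_stepZero (q : ℕ) {B T : MvPowerSeries (Fin 2) k} (hB : B ≠ 0) (hq : ((q : ℕ) : ℕ∞) ≤ B.order)
    (hT : (X 0 : MvPowerSeries (Fin 2) k) ^ q * T = subst (PlaneGerm.dirChart (0 : k)) B) :
    ordAlong 0 T = ((B.order.toNat - q : ℕ) : ℕ∞) := by
  rw [subst_dirChart_zero_eq] at hT
  have hfin := (MvPowerSeries.ne_zero_iff_order_finite).mp hB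
  obtain ⟨m₀, hm₀, hdeg⟩ := MvPowerSeries.exists_coeff_ne_zero_and_order hfin
  set o := B.order.toNat with ho
  have hdeg0 : m₀ 0 + m₀ 1 = o := by
    have h2 : ((m₀ 0 + m₀ 1 : ℕ) : ℕ∞) = (o : ℕ∞) := by rw [← e_deg, hdeg, ← hfin]
    exact_mod_cast h2
  have hqo : q ≤ o := by rw [← hfin] at hq; exact_mod_cast hq
  rw [ordAlong_eq_natCast_iff]
  constructor
  · obtain ⟨-, hcoef⟩ := coeff_eq_of_step' q 0 1 zero_ne_one_fin fin_two_cases B T hT m₀ hm₀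
    refine ⟨_, by rw [hcoef]; exact hm₀, ?_⟩
    rw [e_l]; omega
  · intro m hm
    have h1 := coeff_eq_of_step q 0 1 zero_ne_one_fin fin_two_cases B T hT m
    by_cases hle : m 1 ≤ m 0 + q
    · rw [if_pos hle] at h1
      have hne : coeff (Finsupp.single 0 (m 0 + q - m 1) + Finsupp.single 1 (m 1)) B ≠ 0 := by rw [← h1]; exact hm
      have h2 := MvPowerSeries.order_le hne
      rw [← hfin, e_deg, e_l, e_r] at h2
      have : o ≤ m 0 + q - m 1 + m 1 := by exact_mod_cast h2
      omega
    · rw [if_neg hle] at h1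
      exact absurd h1 hm

/-- the successor is non-zero. -/
theorem ne_zero_stepZero (q : ℕ) {B T : MvPowerSeries (Fin 2) k} (hB : B ≠ 0)
    (hT : (X 0 : MvPowerSeries (Fin 2) k) ^ q * T = subst (PlaneGerm.dirChart (0 : k)) B) : T ≠ 0 := by
  intro h0
  rw [subst_dirChart_zero_eq] at hT
  obtain ⟨m, hm⟩ : ∃ m, coeff m B ≠ 0 := by
    by_contra hnone
    push Not at hnone
    exact hB (MvPowerSeries.ext fun m => by rw [hnone m, map_zero])
  obtain ⟨-, hcoef⟩ := coeff_eq_of_step' q 0 1 zero_ne_one_fin fin_two_cases B T hT m hm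
  rw [h0, map_zero] at hcoef
  exact hm hcoef.symm

/-- **"`d′_res ≤ d_res`"** along the axis successor, for the successor's exceptional letters `E′` (`x ∈ E′`, and `y ∈ E′` iff
`y ∈ E`: "`E′_{a′} = V(xy)` if `t = 0` and `V(y) ⊆ E_a`, `V(x)` if … `V(y) ⊄ E_a`" [HP24 §4 p. 779]). -/
theorem dRes_stepZero_le (q : ℕ) {B T : MvPowerSeries (Fin 2) k} (hB : B ≠ 0) (hq : ((q : ℕ) : ℕ∞) ≤ B.order)
    (hT : (X 0 : MvPowerSeries (Fin 2) k) ^ q * T = subst (PlaneGerm.dirChart (0 : k)) B)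
    {E E' : Finset (Fin 2)} (h0 : (0 : Fin 2) ∈ E') (h1 : (1 : Fin 2) ∈ E' ↔ (1 : Fin 2) ∈ E) :
    dRes T E' ≤ dRes B E := by
  classical
  have hT' := hT
  rw [subst_dirChart_zero_eq] at hT'
  have hfin := (MvPowerSeries.ne_zero_iff_order_finite).mp hB
  obtain ⟨m₀, hm₀, hdeg⟩ := MvPowerSeries.exists_coeff_ne_zero_and_order hfin
  set o := B.order.toNat with ho
  have hdeg0 : m₀ 0 + m₀ 1 = o := by
    have h2 : ((m₀ 0 + m₀ 1 : ℕ) : ℕ∞) = (o : ℕ∞) := by rw [← e_deg, hdeg, ← hfin]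
    exact_mod_cast h2
  have hqo : q ≤ o := by rw [← hfin] at hq; exact_mod_cast hq
  -- the image `n₀` of `m₀` in the successor
  obtain ⟨-, hcoef⟩ := coeff_eq_of_step' q 0 1 zero_ne_one_fin fin_two_cases B T hT' m₀ hm₀
  set n₀ : Fin 2 →₀ ℕ := Finsupp.single 0 (m₀ 0 + m₀ 1 - q) + Finsupp.single 1 (m₀ 1) with hn₀
  have hn₀T : coeff n₀ T ≠ 0 := by rw [hcoef]; exact hm₀
  have hTne : T ≠ 0 := ne_zero_stepZero q hB hT
  have hordT := order_toNat_eq_excExp_add_dRes hTne E'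
  have hordB := order_toNat_eq_excExp_add_dRes hB E
  -- `ord T ≤ deg n₀ = o − q + m₀ 1`
  have hTle : T.order.toNat ≤ o - q + m₀ 1 := by
    have h2 := MvPowerSeries.order_le hn₀T
    rw [← (MvPowerSeries.ne_zero_iff_order_finite).mp hTne, e_deg, hn₀, e_l, e_r] at h2
    have : T.order.toNat ≤ m₀ 0 + m₀ 1 - q + m₀ 1 := by exact_mod_cast h2
    omega
  -- the exponents
  have hx' : excExp T E' 0 = o - q := by
    rw [excExp_apply, if_pos h0, ordAlong_zero_stepZero q hB hq hT]; rfl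
  have hxB : excExp B E 0 ≤ m₀ 0 := excExp_le_of_coeff_ne_zero B E hm₀ 0
  have hy' : excExp T E' 1 = excExp B E 1 := by
    rw [excExp_apply, excExp_apply, ordAlong_one_stepZero q hT]
    by_cases hy : (1 : Fin 2) ∈ E
    · rw [if_pos (h1.mpr hy), if_pos hy]
    · rw [if_neg (fun h => hy (h1.mp h)), if_neg hy]
  have hyB : excExp B E 1 ≤ m₀ 1 := excExp_le_of_coeff_ne_zero B E hm₀ 1
  rw [← ho] at hordB
  omega

/-! ### [HP24, Prop. 4] case (iii) on the game side: tangent flags of the axis successor -/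

/-- **the flag `y + h(x)` of the successor is the flag `y + x·h(x)` of the parent**: `x^q · expansion q T h =
(expansion q B (X·h))(x, xy)` ("`F′₁(x,y) = x^{−pᵉ}F₀(x,xy)`" [HP24 Prop. 4 (iii) p. 795]). -/
theorem X_pow_mul_expansion_stepZero (q : ℕ) {B T : MvPowerSeries (Fin 2) k}
    (hT : (X 0 : MvPowerSeries (Fin 2) k) ^ q * T = subst (PlaneGerm.dirChart (0 : k)) B) (h : PowerSeries k)
    (h0 : PowerSeries.constantCoeff h = 0) :
    (X 0 : MvPowerSeries (Fin 2) k) ^ q * expansion q T h =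
      subst (fun l : Fin 2 => if l = (1 : Fin 2) then (X 0 : MvPowerSeries (Fin 2) k) * X 1 else X l)
        (expansion q B (PowerSeries.X * h)) := by
  rw [subst_dirChart_zero_eq] at hT
  unfold expansion
  rw [shift_eq, shift_eq]
  exact X_pow_mul_cleanShift_eq_step q 0 1 zero_ne_one_fin fin_two_cases B T hT h h0

/-- **"`d^curv_𝓖 = d^curv_𝓕` … Hence `d_𝓖 = d_𝓕`"**: `dFlag q T h n = dFlag q B (X·h) (n + 1)` along the axis successor.
[HP24 Prop. 4 (iii) p. 795 l. 27–30] -/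
theorem dFlag_stepZero_eq (q : ℕ) {B T : MvPowerSeries (Fin 2) k}
    (hT : (X 0 : MvPowerSeries (Fin 2) k) ^ q * T = subst (PlaneGerm.dirChart (0 : k)) B) (h : PowerSeries k)
    (h0 : PowerSeries.constantCoeff h = 0) (n : ℕ) :
    dFlag q T h n = dFlag q B (PowerSeries.X * h) (n + 1) := by
  have hstep := X_pow_mul_expansion_stepZero q hT h h0
  have hwx : weights (n + 1) (0 : Fin 2) = weights n 0 := by unfold weights; rw [if_neg (by decide), if_neg (by decide)]
  have hwy : weights (n + 1) (1 : Fin 2) = weights n 1 + weights n 0 := by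
    unfold weights; rw [if_pos rfl, if_pos rfl, if_neg (by decide)]
  unfold dFlag dcurv wFlag
  exact dFlagShape_eq_of_step q 0 1 zero_ne_one_fin fin_two_cases _ _ hstep _ _ hwx hwy

/-- the tangency order of `X·h` is one more. [HP24 Prop. 4 (iii): "n_𝓕 = ord h + 1 = n_𝓖 + 1"] -/
theorem tangency_X_mul {h : PowerSeries k} (hh : h ≠ 0) : tangency (PowerSeries.X * h) = tangency h + 1 := by
  unfold tangency
  have hfin : h.order = (h.order.toNat : ℕ∞) := (PowerSeries.coe_toNat_order hh).symm
  rw [PowerSeries.order_mul, PowerSeries.order_X, hfin, ← Nat.cast_one, ← Nat.cast_add, ENat.toNat_coe, ENat.toNat_coe,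
    add_comm]

/-- **`X·h` is a tangent flag of the parent** when `h` is a tangent flag of the successor and `y` stays exceptional.
[HP24 Prop. 4 (iii) p. 795 l. 20–27] -/
theorem isTangent_X_mul {E E' : Finset (Fin 2)} (h1 : (1 : Fin 2) ∈ E' ↔ (1 : Fin 2) ∈ E) {h : PowerSeries k}
    (h0 : PowerSeries.constantCoeff h = 0) (hTan : IsTangent E' h) : IsTangent E (PowerSeries.X * h) := by
  obtain ⟨hy, hh, -⟩ := hTan
  refine ⟨h1.mp hy, mul_ne_zero PowerSeries.X_ne_zero hh, Or.inl ?_⟩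
  have h1le : (1 : ℕ∞) ≤ h.order := by
    rw [Order.one_le_iff_ne_zero]; exact PowerSeries.order_ne_zero_iff_constCoeff_eq_zero.mpr h0
  rw [PowerSeries.order_mul, PowerSeries.order_X]
  calc (2 : ℕ∞) = 1 + 1 := by norm_num
    _ ≤ 1 + h.order := add_le_add le_rfl h1le

/-- **[HP24, Prop. 4] case (iii) ON THE GAME SIDE**: along the axis successor `X 0 ^ q · T = B(x, xy)`, every tangent flag `h` of the
successor (letters `E′` with `x ∈ E′`, `y ∈ E′ ↔ y ∈ E`) is strictly dominated by the tangent flag `X·h` of the parent: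
`flagTriple q T E′ h < flagTriple q B E (X·h)`, an admissible flag triple of `(B, E)` — "`d_𝓖 = d_𝓕`. Since `n_𝓖 < n_𝓕`, this
proves `inv^𝓖_{a′}(X′) < inv^𝓕_a(X)`" [HP24 Prop. 4 (iii) p. 795 l. 20–31]. -/
theorem exists_gt_of_isTangent_stepZero (q : ℕ) {B T : MvPowerSeries (Fin 2) k}
    (hT : (X 0 : MvPowerSeries (Fin 2) k) ^ q * T = subst (PlaneGerm.dirChart (0 : k)) B) {E E' : Finset (Fin 2)}
    (h1 : (1 : Fin 2) ∈ E' ↔ (1 : Fin 2) ∈ E) (h : PowerSeries k) (h0 : PowerSeries.constantCoeff h = 0)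
    (hTan : IsTangent E' h) :
    ∃ v : Triple, IsFlagTriple q B E v ∧ flagTriple q T E' h < v := by
  have hTan' := isTangent_X_mul h1 h0 hTan
  refine ⟨flagTriple q B E (PowerSeries.X * h), ⟨false, PowerSeries.X * h, by rw [map_mul, PowerSeries.constantCoeff_X, zero_mul],
    Or.inr hTan', rfl⟩, ?_⟩
  rw [flagTriple_of_not_isN0 q T hTan.not_isN0, flagTriple_of_not_isN0 q B hTan'.not_isN0, tangency_X_mul hTan.2.1,
    dFlag_stepZero_eq q hT h h0 (tangency h), Prod.Lex.toLex_lt_toLex]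
  right
  refine ⟨rfl, ?_⟩
  rw [Prod.Lex.toLex_lt_toLex]
  left
  exact Nat.lt_succ_self _

end PurePowerFlag

end Summit.ResolutionOfSingularities.ResolutionOfSingularities.Theorems
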